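import Mathlib.Analysis.InnerProductSpace.PiL2

/-!
# Explicit spherical configurations from coordinate lists (kernel-checkable distance distributions)

Framing: lottery ticket; floor = certified bounds/negative ranges. Venture `PackingBounds` (cell
`pub-packcert`, seat `pub-packcert-energy`), the **attained side** of the cell's bounds: the optimal
configurations themselves (E₈ roots, the `56`/`27`/`16`-point sharp configurations, the 24-cell, the
icosahedron and the 600-cell over `ℤ[√5]`, Leech-lattice sections, …) as explicit `Finset`s of unit
vectors whose cardinality, norms and *distance distribution* are verified by the kernel.

A configuration is entered as a list `L` of coordinate lists over a commutative ring `R` with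
decidable equality (`ℤ`, or `ℤ√d` for the `ℚ(√5)`/`ℚ(√2)`/`ℚ(√3)` configurations) together with a ring
homomorphism `ι : R →+* ℝ` and the common value `q` of the self-dot-products; the point attached to
`l ∈ L` is `vec ι n q l = (ι q)^{-1/2} · (ι l₀, …, ι l_{n-1}) ∈ ℝⁿ`, a unit vector, and
`⟪vec l, vec l'⟫ = ι(l·l') / ι(q)`. The Boolean programs `shapeOK` (lengths and norms), `keysOK` and
`histOK` (for every row `v`: the multiset `{v·w : w ∈ L, w ≠ v}` has exactly the multiplicities of the
table `D` and no other value) are run by `decide`; the theorems of this file turn `= true` into: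
`‖x‖ = 1` on the configuration (`norm_eq_one`), its cardinality (`card_eq`), the pairwise inner products
lie in the table (`inner_mem`, `inner_le`), and the **energy identity**
`Σ_{x ≠ y} a(⟪x,y⟫) = |L| · Σ_{(d,m) ∈ D} m · a(ι d / ι q)` for every potential `a` (`energy_eq`).
Per-configuration files supply the data and combine these with the cell's upper bounds
(`Kissing/`, `SphericalCodes/`) and universal-optimality lower bounds (`Energy/UniversalOptimality*`)
into two-sided theorems (`κ(8) = 240`, ground-state energies as `IsLeast` statements).
-/

namespace Summit.Ventures.PackingBounds.Config

open Finset WithLp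

variable {R : Type*} [CommRing R]

/-- Dot product of two coordinate lists (truncating at the shorter one). -/
def dotL : List R → List R → R
  | a :: l, b :: l' => a * b + dotL l l'
  | _, _ => 0

section checks

variable [DecidableEq R]

/-- Shape check: every coordinate list has length `n` and self-dot-product `q`. -/
def shapeOK (L : List (List R)) (n : ℕ) (q : R) : Bool :=
  L.all fun v => v.length == n && dotL v v == q

/-- Table check: the keys of the distance table `D` are pairwise distinct and differ from `q`. -/
def keysOK (D : List (R × ℕ)) (q : R) : Bool :=
  decide ((D.map Prod.fst).Nodup) && D.all fun p => !(p.1 == q)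

/-- Row check: the dot products of `v` with the other members of `L` take each key of `D` exactly the
tabulated number of times and no value outside the keys of `D`. -/
def rowHistOK (L : List (List R)) (D : List (R × ℕ)) (v : List R) : Bool :=
  (D.all fun p => ((L.erase v).map (dotL v)).count p.1 == p.2) &&
    (((L.erase v).map (dotL v)).all fun d => (D.map Prod.fst).elem d)

/-- Histogram check for a list of rows (kept separate from `L` so that big configurations can be
checked in chunks). -/
def histOK (L : List (List R)) (D : List (R × ℕ)) (rows : List (List R)) : Bool :=
  rows.all (rowHistOK L D)

/-- Compact entry of coordinate lists for large configurations: the `n` base-`B` digits of `c`,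
each shifted down by `o` (so digit `k` encodes the coordinate `k - o`). -/
def decode (B o n : ℕ) (c : ℕ) : List ℤ :=
  (List.range n).map fun i => ((c / B ^ i % B : ℕ) : ℤ) - o

/-- `histOK` is multiplicative in the row list (chunking of big checks). -/
theorem histOK_append (L : List (List R)) (D : List (R × ℕ)) (r₁ r₂ : List (List R)) :
    histOK L D (r₁ ++ r₂) = (histOK L D r₁ && histOK L D r₂) := by
  simp [histOK, List.all_append]

end checks

/-- The unit vector of `ℝⁿ` attached to a coordinate list: `(ι q)^{-1/2} · (ι l_i)_i`. -/
noncomputable def vec (ι : R →+* ℝ) (n : ℕ) (q : R) (l : List R) : EuclideanSpace ℝ (Fin n) :=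
  toLp 2 fun i => (Real.sqrt (ι q))⁻¹ * ι (l.getD i 0)

/-- The configuration attached to a list of coordinate lists. -/
noncomputable def config (ι : R →+* ℝ) (n : ℕ) (q : R) (L : List (List R)) :
    Finset (EuclideanSpace ℝ (Fin n)) :=
  (L.map (vec ι n q)).toFinset

variable (ι : R →+* ℝ) (n : ℕ) (q : R)

/-- Coordinate sums of products are the image of `dotL`. -/
theorem sum_getD_mul_getD (l l' : List R) (hl : l.length = n) (hl' : l'.length = n) :
    ∑ i : Fin n, ι (l.getD i 0) * ι (l'.getD i 0) = ι (dotL l l') := by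
  induction n generalizing l l' with
  | zero =>
    cases l with
    | nil => cases l' with
      | nil => simp [dotL]
      | cons b t' => simp at hl'
    | cons a t => simp at hl
  | succ m ih =>
    cases l with
    | nil => simp at hl
    | cons a t =>
      cases l' with
      | nil => simp at hl'
      | cons b t' =>
        simp only [List.length_cons, Nat.add_right_cancel_iff] at hl hl'
        rw [Fin.sum_univ_succ]
        simp only [Fin.val_zero, List.getD_cons_zero, Fin.val_succ, List.getD_cons_succ, dotL,
          map_add, map_mul]
        rw [ih t t' hl hl']

/-- `⟪vec l, vec l'⟫ = ι(l·l') / ι(q)` for lists of length `n` (when `ι q > 0`). -/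
theorem inner_vec (hq : 0 < ι q) (l l' : List R) (hl : l.length = n) (hl' : l'.length = n) :
    inner ℝ (vec ι n q l) (vec ι n q l') = ι (dotL l l') / ι q := by
  rw [vec, vec, EuclideanSpace.inner_toLp_toLp, dotProduct]
  have hs : Real.sqrt (ι q) ^ 2 = ι q := Real.sq_sqrt hq.le
  simp only [star_trivial]
  calc ∑ i : Fin n, (Real.sqrt (ι q))⁻¹ * ι (l'.getD i 0) * ((Real.sqrt (ι q))⁻¹ * ι (l.getD i 0))
      = (Real.sqrt (ι q))⁻¹ ^ 2 * ∑ i : Fin n, ι (l.getD i 0) * ι (l'.getD i 0) := by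
        rw [Finset.mul_sum]; exact Finset.sum_congr rfl fun i _ => by ring
    _ = ι (dotL l l') / ι q := by
        rw [sum_getD_mul_getD ι n l l' hl hl', inv_pow, hs]; ring

/-- `vec l` is a unit vector when `l·l = q`. -/
theorem norm_vec (hq : 0 < ι q) (l : List R) (hl : l.length = n) (hll : dotL l l = q) :
    ‖vec ι n q l‖ = 1 := by
  have h := inner_vec ι n q hq l l hl hl
  rw [hll, div_self hq.ne', real_inner_self_eq_norm_sq] at h
  nlinarith [norm_nonneg (vec ι n q l)]

section props

variable [DecidableEq R] {ι n q}
variable {L : List (List R)} {D : List (R × ℕ)}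

/-- The shape check gives the lengths. -/
theorem length_of_shapeOK (h : shapeOK L n q = true) {l : List R} (hl : l ∈ L) : l.length = n := by
  simp only [shapeOK, List.all_eq_true, Bool.and_eq_true, beq_iff_eq] at h
  exact (h l hl).1

/-- The shape check gives the self-dot-products. -/
theorem dot_self_of_shapeOK (h : shapeOK L n q = true) {l : List R} (hl : l ∈ L) : dotL l l = q := by
  simp only [shapeOK, List.all_eq_true, Bool.and_eq_true, beq_iff_eq] at h
  exact (h l hl).2

omit [DecidableEq R] in
/-- Membership in the configuration. -/
theorem mem_config {x : EuclideanSpace ℝ (Fin n)} :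
    x ∈ config ι n q L ↔ ∃ l ∈ L, vec ι n q l = x := by
  simp [config]

/-- Every point of the configuration is a unit vector. -/
theorem norm_eq_one (hq : 0 < ι q) (hS : shapeOK L n q = true) :
    ∀ x ∈ config ι n q L, ‖x‖ = 1 := by
  intro x hx
  obtain ⟨l, hl, rfl⟩ := mem_config.1 hx
  exact norm_vec ι n q hq l (length_of_shapeOK hS hl) (dot_self_of_shapeOK hS hl)

/-- The dot product of two distinct members is a key of the table. -/
theorem dot_mem_keys (hH : histOK L D L = true) {l l' : List R} (hl : l ∈ L) (hl' : l' ∈ L)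
    (hne : l ≠ l') : dotL l l' ∈ D.map Prod.fst := by
  simp only [histOK, List.all_eq_true] at hH
  have h := hH l hl
  simp only [rowHistOK, Bool.and_eq_true, List.all_eq_true, List.mem_map] at h
  have h2 := h.2 (dotL l l') ⟨l', (List.mem_erase_of_ne (Ne.symm hne)).2 hl', rfl⟩
  simpa using h2

/-- Inner products of distinct members of `L`: `⟪vec l, vec l'⟫ = ι d / ι q` with `d` a key of `D`. -/
theorem inner_vec_mem (hq : 0 < ι q) (hS : shapeOK L n q = true) (hH : histOK L D L = true)
    {l l' : List R} (hl : l ∈ L) (hl' : l' ∈ L) (hne : l ≠ l') :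
    ∃ p ∈ D, inner ℝ (vec ι n q l) (vec ι n q l') = ι p.1 / ι q := by
  obtain ⟨p, hp, hpe⟩ := List.mem_map.1 (dot_mem_keys hH hl hl' hne)
  exact ⟨p, hp, by rw [inner_vec ι n q hq l l' (length_of_shapeOK hS hl) (length_of_shapeOK hS hl'),
    hpe]⟩

/-- `vec` is injective on `L` (distinct members have inner product `≠ 1`). -/
theorem vec_injOn (hι : Function.Injective ι) (hq : 0 < ι q) (hS : shapeOK L n q = true)
    (hK : keysOK D q = true) (hH : histOK L D L = true) :
    ∀ l ∈ L, ∀ l' ∈ L, vec ι n q l = vec ι n q l' → l = l' := by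
  intro l hl l' hl' he
  by_contra hne
  obtain ⟨p, hp, hpe⟩ := inner_vec_mem hq hS hH hl hl' hne
  rw [he, real_inner_self_eq_norm_sq,
    norm_vec ι n q hq l' (length_of_shapeOK hS hl') (dot_self_of_shapeOK hS hl'), one_pow,
    eq_div_iff hq.ne', one_mul] at hpe
  simp only [keysOK, Bool.and_eq_true, decide_eq_true_eq, List.all_eq_true, Bool.not_eq_true',
    beq_eq_false_iff_ne, ne_eq] at hK
  exact hK.2 p hp (hι hpe.symm)

/-- The configuration has `|L|` points. -/
theorem card_eq (hι : Function.Injective ι) (hq : 0 < ι q) (hS : shapeOK L n q = true)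
    (hK : keysOK D q = true) (hH : histOK L D L = true) (hN : L.Nodup) :
    (config ι n q L).card = L.length := by
  rw [config, List.toFinset_card_of_nodup ((hN.map_on (vec_injOn hι hq hS hK hH))), List.length_map]

/-- Pairwise inner products of the configuration lie in the (rescaled) table. -/
theorem inner_mem (hq : 0 < ι q) (hS : shapeOK L n q = true)
    (hH : histOK L D L = true) :
    ∀ x ∈ config ι n q L, ∀ y ∈ config ι n q L, x ≠ y →
      ∃ p ∈ D, inner ℝ x y = ι p.1 / ι q := by
  intro x hx y hy hxy
  obtain ⟨l, hl, rfl⟩ := mem_config.1 hx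
  obtain ⟨l', hl', rfl⟩ := mem_config.1 hy
  have hne : l ≠ l' := fun h => hxy (by rw [h])
  exact inner_vec_mem hq hS hH hl hl' hne

/-- Pairwise inner products are at most `s` as soon as every key of the table is. -/
theorem inner_le (hq : 0 < ι q) (hS : shapeOK L n q = true)
    (hH : histOK L D L = true) (s : ℝ) (hs : ∀ p ∈ D, ι p.1 / ι q ≤ s) :
    ∀ x ∈ config ι n q L, ∀ y ∈ config ι n q L, x ≠ y → inner ℝ x y ≤ s := by
  intro x hx y hy hxy
  obtain ⟨p, hp, he⟩ := inner_mem hq hS hH x hx y hy hxy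
  exact he ▸ hs p hp

omit [CommRing R] in
/-- Counting lemma: a list all of whose entries are keys of `D`, with the tabulated multiplicities,
has `Σ_{d ∈ ds} h(d) = Σ_{(d,m) ∈ D} m · h(d)`. -/
theorem sum_map_eq_of_counts (ds : List R) (h : R → ℝ) (hK : (D.map Prod.fst).Nodup)
    (hc : ∀ p ∈ D, ds.count p.1 = p.2) (hall : ∀ d ∈ ds, d ∈ D.map Prod.fst) :
    (ds.map h).sum = (D.map fun p => (p.2 : ℝ) * h p.1).sum := by
  rw [Finset.sum_list_map_count]
  have hsub : ds.toFinset ⊆ (D.map Prod.fst).toFinset := by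
    intro d hd
    exact List.mem_toFinset.2 (hall d (List.mem_toFinset.1 hd))
  rw [Finset.sum_subset hsub (fun d _ hd => by
    rw [List.count_eq_zero_of_not_mem (fun h' => hd (List.mem_toFinset.2 h')), zero_smul])]
  rw [List.sum_toFinset _ hK, List.map_map]
  congr 1
  refine List.map_congr_left fun p hp => ?_
  simp only [Function.comp_apply, nsmul_eq_mul]
  rw [hc p hp]

/-- **Energy identity.** For every potential `a`, the `a`-energy `Σ_{x ≠ y} a(⟪x,y⟫)` of the
configuration equals `|L| · Σ_{(d,m) ∈ D} m · a(ι d / ι q)`. -/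
theorem energy_eq (hι : Function.Injective ι) (hq : 0 < ι q) (hS : shapeOK L n q = true)
    (hK : keysOK D q = true) (hH : histOK L D L = true) (hN : L.Nodup) (a : ℝ → ℝ) :
    ∑ x ∈ config ι n q L, ∑ y ∈ (config ι n q L).erase x, a (inner ℝ x y) =
      (L.length : ℝ) * (D.map fun p => (p.2 : ℝ) * a (ι p.1 / ι q)).sum := by
  have hinj := vec_injOn hι hq hS hK hH
  have hK' : (D.map Prod.fst).Nodup := by
    simp only [keysOK, Bool.and_eq_true, decide_eq_true_eq] at hK; exact hK.1
  set S := (D.map fun p => (p.2 : ℝ) * a (ι p.1 / ι q)).sum with hSdef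
  rw [config, List.sum_toFinset _ (hN.map_on hinj), List.map_map]
  have hrow : ∀ l ∈ L, ∑ y ∈ (List.map (vec ι n q) L).toFinset.erase (vec ι n q l),
      a (inner ℝ (vec ι n q l) y) = S := by
    intro l hl
    have hE : (List.map (vec ι n q) L).toFinset.erase (vec ι n q l) =
        ((L.erase l).map (vec ι n q)).toFinset := by
      ext y
      simp only [Finset.mem_erase, List.mem_toFinset, List.mem_map]
      constructor
      · rintro ⟨hy, l', hl', rfl⟩
        exact ⟨l', (hN.mem_erase_iff).2 ⟨fun h => hy (by rw [h]), hl'⟩, rfl⟩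
      · rintro ⟨l', hl', rfl⟩
        have h2 := (hN.mem_erase_iff).1 hl'
        exact ⟨fun h => h2.1 (hinj l' h2.2 l hl h), l', h2.2, rfl⟩
    rw [hE, List.sum_toFinset _ ((hN.erase l).map_on fun x hx y hy hxy =>
      hinj x (List.mem_of_mem_erase hx) y (List.mem_of_mem_erase hy) hxy), List.map_map]
    have hds : ((L.erase l).map (fun l' => a (inner ℝ (vec ι n q l) (vec ι n q l')))) =
        (((L.erase l).map (dotL l)).map fun d => a (ι d / ι q)) := by
      rw [List.map_map]
      refine List.map_congr_left fun l' hl' => ?_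
      simp only [Function.comp_apply]
      rw [inner_vec ι n q hq l l' (length_of_shapeOK hS hl)
        (length_of_shapeOK hS (List.mem_of_mem_erase hl'))]
    simp only [histOK, List.all_eq_true] at hH
    have h := hH l hl
    simp only [rowHistOK, Bool.and_eq_true, List.all_eq_true, beq_iff_eq] at h
    rw [show (fun x => a (inner ℝ (vec ι n q l) x)) ∘ vec ι n q =
        fun l' => a (inner ℝ (vec ι n q l) (vec ι n q l')) from rfl, hds]
    exact sum_map_eq_of_counts _ _ hK' h.1 (fun d hd => by simpa using h.2 d hd)
  rw [show (L.map ((fun x => ∑ y ∈ (List.map (vec ι n q) L).toFinset.erase x,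
      a (inner ℝ x y)) ∘ vec ι n q)) = L.map (fun _ => S) from
    List.map_congr_left fun l hl => hrow l hl]
  simp [List.sum_replicate, List.map_const']

end props

section nodup

variable [DecidableEq R] {n : ℕ} {q : R} {L : List (List R)} {D : List (R × ℕ)}

/-- The checks imply that `L` has no duplicate members: a duplicate of `a ∈ L` would survive in
`L.erase a` and show the non-key `a·a = q` as a dot product. (So instance files need no separate
`Nodup` computation.) -/
theorem nodup_of_checks (hS : shapeOK L n q = true) (hK : keysOK D q = true)
    (hH : histOK L D L = true) : L.Nodup := by
  rw [List.nodup_iff_count_le_one]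
  intro a
  by_contra hlt
  push Not at hlt
  have ha : a ∈ L := List.count_pos_iff.1 (by omega)
  have ha2 : a ∈ L.erase a := by
    rw [← List.count_pos_iff, List.count_erase_self]; omega
  simp only [histOK, List.all_eq_true] at hH
  have h := hH a ha
  simp only [rowHistOK, Bool.and_eq_true, List.all_eq_true, List.mem_map] at h
  have hkey := h.2 (dotL a a) ⟨a, ha2, rfl⟩
  rw [dot_self_of_shapeOK hS ha] at hkey
  simp only [List.elem_eq_mem, decide_eq_true_eq, List.mem_map] at hkey
  obtain ⟨p, hp, hpq⟩ := hkey
  simp only [keysOK, Bool.and_eq_true, decide_eq_true_eq, List.all_eq_true, Bool.not_eq_true',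
    beq_eq_false_iff_ne, ne_eq] at hK
  exact hK.2 p hp hpq

end nodup

end Summit.Ventures.PackingBounds.Config
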